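import Mathlib
import Summits.Ventures.HodgeRepro.Tier4.Target
import Summits.Ventures.HodgeRepro.Tier4.Common.TargetData
import Summits.Ventures.HodgeRepro.Tier4.Common.AutForms
import Summits.Ventures.HodgeRepro.Tier4.Line4.MixedTransfer
import Summits.Ventures.HodgeRepro.Tier4.Line4.Forms11

/-!
# Tier4/Line4/ExactOnBall — exactness on the ball: `∫ ⟨dη ∧ ξ⟩ = 0` for a closed `ξ` and a compactly supported `η`
(SUPPORT for L4.0′ `pair11_descends`)

Blind re-derivation cell `pub-hodge-repro`, Tier 4 (README §9–§10), seat t4-L4-p2 (prover, LINE L4, gen 0).  Tree path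
`lean/Summits/Ventures/HodgeRepro/Tier4/Line4/ExactOnBall.lean`.  Imports, BY NAME, typer-1's `Common/AutForms`
(`isOpen_ball`), plan-4's `Line4/MixedTransfer` (`Form11`, `wedgeCoeff11`) and `Line4/Forms11` (`dz`, `dzbar`,
`IsClosed11`).

WHAT IS PROVED — the boundary-free half of the Stokes argument behind L4.0′ (plan-4 S12264 (b): «exactness for compactly
supported `η` on the ball first»).  For a `1`-form `η = Σ η¹_k dz_k + Σ η²_l dz̄_l` with coefficients `C¹` on the ball and
vanishing off a compact `K ⊆ ball`, and a `(1,1)`-form `ξ` with `C¹` coefficients on the ball and `dξ = 0` (`IsClosed11`):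
`∫_ball ⟨(dη)^{1,1} ∧ ξ⟩ = 0`, where `(dη)^{1,1}_{kl} = ∂_k η²_l − ∂̄_l η¹_k` (the skeleton's `d11`, written out).
Method: the pointwise identity `⟨(dη)^{1,1} ∧ ξ⟩ = Σ ± ∂ (η_a ξ_b)` (Leibniz for the Wirtinger operators + the four
closedness identities of `ξ`, `wedgeCoeff11_d11_eq_sum_dz`), and `∫ ∂_v F = 0` for a function `F` that is `C¹` on the
ball and vanishes off a compact subset of the ball (Mathlib's integration by parts on a Haar measure,
`integral_mul_fderiv_eq_neg_fderiv_mul_of_integrable` against the constant `1`; `integral_fderiv_apply_eq_zero`).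
The remaining half of L4.0′ — the passage from a measurable fundamental domain to the ball (tiling, change of variables,
a cutoff with `Σ_γ χ ∘ γ = 1`) — needs the cocompactness and proper discontinuity of `Γ′`, which are not in the datum
(STATUS S12320, the repair census of L4.0′).

Nothing here says anything about the status of the Hodge conjecture for CM abelian varieties, which is NOT proved
(HC_CM is NOT proved by anyone in this repository).
-/

set_option autoImplicit false

noncomputable section

open Matrix MeasureTheory NumberField Topology
open scoped ComplexConjugate

namespace Summit.Ventures.HodgeRepro.Tier4.Line4

open Summit.Ventures.HodgeRepro.Tier4

/-! ## 1. Functions that are `C¹` on the ball and vanish off a compact subset of it -/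

/-- A function continuous on an open `U` and vanishing off a closed `K ⊆ U` is continuous. -/
theorem continuous_of_continuousOn_of_eqOn_zero {U K : Set (Fin 2 → ℂ)} (hU : IsOpen U) (hK : IsClosed K)
    (hKU : K ⊆ U) {f : (Fin 2 → ℂ) → ℂ} (hf : ContinuousOn f U) (h0 : ∀ z ∉ K, f z = 0) : Continuous f := by
  rw [continuous_iff_continuousAt]
  intro z
  by_cases hz : z ∈ U
  · exact hf.continuousAt (hU.mem_nhds hz)
  · have hzK : z ∉ K := fun h => hz (hKU h)
    have h : (fun _ => (0 : ℂ)) =ᶠ[𝓝 z] f := by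
      filter_upwards [hK.isOpen_compl.mem_nhds hzK] with w hw
      exact (h0 w hw).symm
    exact continuousAt_const.congr h

/-- A function continuous on an open `U` and vanishing off a compact `K ⊆ U` is integrable. -/
theorem integrable_of_continuousOn_of_eqOn_zero {U K : Set (Fin 2 → ℂ)} (hU : IsOpen U) (hK : IsCompact K)
    (hKU : K ⊆ U) {f : (Fin 2 → ℂ) → ℂ} (hf : ContinuousOn f U) (h0 : ∀ z ∉ K, f z = 0) : Integrable f := by
  have hc : Continuous f := continuous_of_continuousOn_of_eqOn_zero hU hK.isClosed hKU hf h0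
  have hs : HasCompactSupport f :=
    HasCompactSupport.of_support_subset_isCompact hK fun z hz => by_contra fun h => hz (h0 z h)
  exact hc.integrable_of_hasCompactSupport hs

/-- A function vanishing off a closed `K` has zero derivative off `K`. -/
theorem fderiv_eq_zero_of_notMem {K : Set (Fin 2 → ℂ)} (hK : IsClosed K) {f : (Fin 2 → ℂ) → ℂ}
    (h0 : ∀ z ∉ K, f z = 0) {z : Fin 2 → ℂ} (hz : z ∉ K) : fderiv ℝ f z = 0 := by
  have h : f =ᶠ[𝓝 z] fun _ => (0 : ℂ) := by
    filter_upwards [hK.isOpen_compl.mem_nhds hz] with w hw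
    exact h0 w hw
  rw [h.fderiv_eq]
  simp

/-- A function `C¹` on the ball and vanishing off a closed `K ⊆ ball` is differentiable everywhere. -/
theorem differentiableAt_of_contDiffOn_ball {K : Set (Fin 2 → ℂ)} (hK : IsClosed K) (hKb : K ⊆ ball)
    {f : (Fin 2 → ℂ) → ℂ} (hf : ContDiffOn ℝ 1 f ball) (h0 : ∀ z ∉ K, f z = 0) (z : Fin 2 → ℂ) :
    DifferentiableAt ℝ f z := by
  by_cases hz : z ∈ ball
  · exact (hf.differentiableOn one_ne_zero).differentiableAt (isOpen_ball.mem_nhds hz)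
  · have hzK : z ∉ K := fun h => hz (hKb h)
    have h : (fun _ => (0 : ℂ)) =ᶠ[𝓝 z] f := by
      filter_upwards [hK.isOpen_compl.mem_nhds hzK] with w hw
      exact (h0 w hw).symm
    exact (differentiableAt_const _).congr_of_eventuallyEq h.symm

/-- **`∫ ∂_v F = 0`** for `F` `C¹` on the ball and vanishing off a compact `K ⊆ ball` (integration by parts against
the constant `1`, Mathlib `integral_mul_fderiv_eq_neg_fderiv_mul_of_integrable`). -/
theorem integral_fderiv_apply_eq_zero {K : Set (Fin 2 → ℂ)} (hK : IsCompact K) (hKb : K ⊆ ball)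
    {F : (Fin 2 → ℂ) → ℂ} (hF : ContDiffOn ℝ 1 F ball) (h0 : ∀ z ∉ K, F z = 0) (v : Fin 2 → ℂ) :
    ∫ z, fderiv ℝ F z v = 0 := by
  have hFd : ∀ z, DifferentiableAt ℝ F z := differentiableAt_of_contDiffOn_ball hK.isClosed hKb hF h0
  have hF'c : ContinuousOn (fun z => fderiv ℝ F z v) ball :=
    ((hF.continuousOn_fderiv_of_isOpen isOpen_ball le_rfl).clm_apply continuousOn_const)
  have hF'0 : ∀ z ∉ K, fderiv ℝ F z v = 0 := fun z hz => by
    rw [fderiv_eq_zero_of_notMem hK.isClosed h0 hz]; rfl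
  have hint : Integrable (fun z => fderiv ℝ F z v) :=
    integrable_of_continuousOn_of_eqOn_zero isOpen_ball hK hKb hF'c hF'0
  have hFint : Integrable F := integrable_of_continuousOn_of_eqOn_zero isOpen_ball hK hKb hF.continuousOn h0
  have key := integral_mul_fderiv_eq_neg_fderiv_mul_of_integrable (μ := volume) (f := F) (g := fun _ => (1 : ℂ))
    (v := v) (by simpa using hint) (by simp) (by simpa using hFint) (fun z _ => hFd z)
    (fun z _ => differentiableAt_const _)
  simpa using key

/-- `z ↦ fderiv ℝ F z v` is integrable for `F` `C¹` on the ball and vanishing off a compact `K ⊆ ball`. -/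
theorem integrable_fderiv_apply {K : Set (Fin 2 → ℂ)} (hK : IsCompact K) (hKb : K ⊆ ball)
    {F : (Fin 2 → ℂ) → ℂ} (hF : ContDiffOn ℝ 1 F ball) (h0 : ∀ z ∉ K, F z = 0) (v : Fin 2 → ℂ) :
    Integrable (fun z => fderiv ℝ F z v) := by
  refine integrable_of_continuousOn_of_eqOn_zero isOpen_ball hK hKb
    ((hF.continuousOn_fderiv_of_isOpen isOpen_ball le_rfl).clm_apply continuousOn_const) fun z hz => ?_
  rw [fderiv_eq_zero_of_notMem hK.isClosed h0 hz]; rfl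

/-! ## 2. The Wirtinger operators: `∫ ∂_k F = 0`, `∫ ∂̄_k F = 0`, Leibniz -/

/-- **`∫ ∂_k F = 0`** for `F` `C¹` on the ball and vanishing off a compact `K ⊆ ball`. -/
theorem integral_dz_eq_zero {K : Set (Fin 2 → ℂ)} (hK : IsCompact K) (hKb : K ⊆ ball)
    {F : (Fin 2 → ℂ) → ℂ} (hF : ContDiffOn ℝ 1 F ball) (h0 : ∀ z ∉ K, F z = 0) (k : Fin 2) :
    ∫ z, dz k F z = 0 := by
  unfold dz
  rw [integral_const_mul, integral_sub (integrable_fderiv_apply hK hKb hF h0 _)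
    ((integrable_fderiv_apply hK hKb hF h0 _).const_mul _), integral_const_mul,
    integral_fderiv_apply_eq_zero hK hKb hF h0, integral_fderiv_apply_eq_zero hK hKb hF h0]
  simp

/-- **`∫ ∂̄_k F = 0`** for `F` `C¹` on the ball and vanishing off a compact `K ⊆ ball`. -/
theorem integral_dzbar_eq_zero {K : Set (Fin 2 → ℂ)} (hK : IsCompact K) (hKb : K ⊆ ball)
    {F : (Fin 2 → ℂ) → ℂ} (hF : ContDiffOn ℝ 1 F ball) (h0 : ∀ z ∉ K, F z = 0) (k : Fin 2) :
    ∫ z, dzbar k F z = 0 := by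
  unfold dzbar
  rw [integral_const_mul, integral_add (integrable_fderiv_apply hK hKb hF h0 _)
    ((integrable_fderiv_apply hK hKb hF h0 _).const_mul _), integral_const_mul,
    integral_fderiv_apply_eq_zero hK hKb hF h0, integral_fderiv_apply_eq_zero hK hKb hF h0]
  simp

/-- `∂_k F` is integrable for `F` `C¹` on the ball and vanishing off a compact `K ⊆ ball`. -/
theorem integrable_dz {K : Set (Fin 2 → ℂ)} (hK : IsCompact K) (hKb : K ⊆ ball)
    {F : (Fin 2 → ℂ) → ℂ} (hF : ContDiffOn ℝ 1 F ball) (h0 : ∀ z ∉ K, F z = 0) (k : Fin 2) :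
    Integrable (dz k F) := by
  show Integrable (fun z => (1 / 2 : ℂ) * (fderiv ℝ F z (Pi.single k 1) - Complex.I * fderiv ℝ F z (Pi.single k Complex.I)))
  exact ((integrable_fderiv_apply hK hKb hF h0 _).sub
    ((integrable_fderiv_apply hK hKb hF h0 _).const_mul _)).const_mul _

/-- `∂̄_k F` is integrable for `F` `C¹` on the ball and vanishing off a compact `K ⊆ ball`. -/
theorem integrable_dzbar {K : Set (Fin 2 → ℂ)} (hK : IsCompact K) (hKb : K ⊆ ball)
    {F : (Fin 2 → ℂ) → ℂ} (hF : ContDiffOn ℝ 1 F ball) (h0 : ∀ z ∉ K, F z = 0) (k : Fin 2) :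
    Integrable (dzbar k F) := by
  show Integrable (fun z => (1 / 2 : ℂ) * (fderiv ℝ F z (Pi.single k 1) + Complex.I * fderiv ℝ F z (Pi.single k Complex.I)))
  exact ((integrable_fderiv_apply hK hKb hF h0 _).add
    ((integrable_fderiv_apply hK hKb hF h0 _).const_mul _)).const_mul _

/-- **Leibniz for `∂_k`**: `∂_k (f g) = ∂_k f · g + f · ∂_k g` at a point where `f, g` are ℝ-differentiable. -/
theorem dz_mul {f g : (Fin 2 → ℂ) → ℂ} {z : Fin 2 → ℂ} (hf : DifferentiableAt ℝ f z) (hg : DifferentiableAt ℝ g z)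
    (k : Fin 2) : dz k (fun w => f w * g w) z = dz k f z * g z + f z * dz k g z := by
  unfold dz
  rw [fderiv_fun_mul hf hg]
  simp only [_root_.add_apply, _root_.smul_apply, smul_eq_mul]
  ring

/-- **Leibniz for `∂̄_k`**: `∂̄_k (f g) = ∂̄_k f · g + f · ∂̄_k g` at a point where `f, g` are ℝ-differentiable. -/
theorem dzbar_mul {f g : (Fin 2 → ℂ) → ℂ} {z : Fin 2 → ℂ} (hf : DifferentiableAt ℝ f z)
    (hg : DifferentiableAt ℝ g z) (k : Fin 2) :
    dzbar k (fun w => f w * g w) z = dzbar k f z * g z + f z * dzbar k g z := by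
  unfold dzbar
  rw [fderiv_fun_mul hf hg]
  simp only [_root_.add_apply, _root_.smul_apply, smul_eq_mul]
  ring

/-- `∂_k F z = 0` off a closed set `K` off which `F` vanishes. -/
theorem dz_eq_zero_of_notMem {K : Set (Fin 2 → ℂ)} (hK : IsClosed K) {F : (Fin 2 → ℂ) → ℂ}
    (h0 : ∀ z ∉ K, F z = 0) {z : Fin 2 → ℂ} (hz : z ∉ K) (k : Fin 2) : dz k F z = 0 := by
  unfold dz; rw [fderiv_eq_zero_of_notMem hK h0 hz]; simp

/-- `∂̄_k F z = 0` off a closed set `K` off which `F` vanishes. -/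
theorem dzbar_eq_zero_of_notMem {K : Set (Fin 2 → ℂ)} (hK : IsClosed K) {F : (Fin 2 → ℂ) → ℂ}
    (h0 : ∀ z ∉ K, F z = 0) {z : Fin 2 → ℂ} (hz : z ∉ K) (k : Fin 2) : dzbar k F z = 0 := by
  unfold dzbar; rw [fderiv_eq_zero_of_notMem hK h0 hz]; simp

/-! ## 3. Exactness on the ball -/

/-- `⟨(dη)^{1,1} ∧ ξ⟩` written out: `(dη)^{1,1}_{kl} = ∂_k η²_l − ∂̄_l η¹_k`. -/
theorem wedgeCoeff11_d11_expand (η₁ η₂ : (Fin 2 → ℂ) → (Fin 2 → ℂ)) (ξ : (Fin 2 → ℂ) → Form11) (z : Fin 2 → ℂ) :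
    wedgeCoeff11 (Matrix.of fun k l => dz k (fun w => η₂ w l) z - dzbar l (fun w => η₁ w k) z) (ξ z) =
      -((dz 0 (fun w => η₂ w 0) z - dzbar 0 (fun w => η₁ w 0) z) * ξ z 1 1
        - (dz 0 (fun w => η₂ w 1) z - dzbar 1 (fun w => η₁ w 0) z) * ξ z 1 0
        - (dz 1 (fun w => η₂ w 0) z - dzbar 0 (fun w => η₁ w 1) z) * ξ z 0 1
        + (dz 1 (fun w => η₂ w 1) z - dzbar 1 (fun w => η₁ w 1) z) * ξ z 0 0) := by
  simp [wedgeCoeff11]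

/-- Eight integrals that vanish combine to zero. -/
theorem integral_comb_eight {A B C D E F G H : (Fin 2 → ℂ) → ℂ} (hA : Integrable A) (hB : Integrable B)
    (hC : Integrable C) (hD : Integrable D) (hE : Integrable E) (hF : Integrable F) (hG : Integrable G)
    (hH : Integrable H) (zA : ∫ z, A z = 0) (zB : ∫ z, B z = 0) (zC : ∫ z, C z = 0) (zD : ∫ z, D z = 0)
    (zE : ∫ z, E z = 0) (zF : ∫ z, F z = 0) (zG : ∫ z, G z = 0) (zH : ∫ z, H z = 0) :
    ∫ z, -(A z - B z - C z + D z - E z + F z + G z - H z) = 0 := by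
  have h1 : Integrable (fun z => A z - B z) := hA.sub hB
  have h2 : Integrable (fun z => A z - B z - C z) := h1.sub hC
  have h3 : Integrable (fun z => A z - B z - C z + D z) := h2.add hD
  have h4 : Integrable (fun z => A z - B z - C z + D z - E z) := h3.sub hE
  have h5 : Integrable (fun z => A z - B z - C z + D z - E z + F z) := h4.add hF
  have h6 : Integrable (fun z => A z - B z - C z + D z - E z + F z + G z) := h5.add hG
  rw [integral_neg, integral_sub h6 hH, integral_add h5 hG, integral_add h4 hF, integral_sub h3 hE,
    integral_add h2 hD, integral_sub h1 hC, integral_sub hA hB, zA, zB, zC, zD, zE, zF, zG, zH]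
  simp

/-- **The pointwise divergence identity**: for `η` vanishing off a closed `K ⊆ ball` with `C¹` coefficients on the
ball and `ξ` closed with `C¹` coefficients on the ball, `⟨(dη)^{1,1} ∧ ξ⟩ = −(∂₀(η²₀ ξ₁₁) − ∂̄₀(η¹₀ ξ₁₁) − ∂₀(η²₁ ξ₁₀)
+ ∂̄₁(η¹₀ ξ₁₀) − ∂₁(η²₀ ξ₀₁) + ∂̄₀(η¹₁ ξ₀₁) + ∂₁(η²₁ ξ₀₀) − ∂̄₁(η¹₁ ξ₀₀))` at EVERY point (Leibniz and the four
closedness identities on the ball; both sides vanish off `K`). -/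
theorem wedgeCoeff11_d11_eq_sum_dz {K : Set (Fin 2 → ℂ)} (hK : IsClosed K) (hKb : K ⊆ ball)
    {η₁ η₂ : (Fin 2 → ℂ) → (Fin 2 → ℂ)} (hη₁ : ∀ k, ContDiffOn ℝ 1 (fun z => η₁ z k) ball)
    (hη₂ : ∀ k, ContDiffOn ℝ 1 (fun z => η₂ z k) ball) (h0 : ∀ z ∉ K, η₁ z = 0 ∧ η₂ z = 0)
    {ξ : (Fin 2 → ℂ) → Form11} (hξ : ∀ k l, ContDiffOn ℝ 1 (fun z => ξ z k l) ball) (hcl : IsClosed11 ξ)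
    (z : Fin 2 → ℂ) :
    wedgeCoeff11 (Matrix.of fun k l => dz k (fun w => η₂ w l) z - dzbar l (fun w => η₁ w k) z) (ξ z) =
      -(dz 0 (fun w => η₂ w 0 * ξ w 1 1) z - dzbar 0 (fun w => η₁ w 0 * ξ w 1 1) z
        - dz 0 (fun w => η₂ w 1 * ξ w 1 0) z + dzbar 1 (fun w => η₁ w 0 * ξ w 1 0) z
        - dz 1 (fun w => η₂ w 0 * ξ w 0 1) z + dzbar 0 (fun w => η₁ w 1 * ξ w 0 1) z
        + dz 1 (fun w => η₂ w 1 * ξ w 0 0) z - dzbar 1 (fun w => η₁ w 1 * ξ w 0 0) z) := by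
  rw [wedgeCoeff11_d11_expand]
  have h01 : ∀ z ∉ K, ∀ k, η₁ z k = 0 := fun z hz k => by rw [(h0 z hz).1]; rfl
  have h02 : ∀ z ∉ K, ∀ k, η₂ z k = 0 := fun z hz k => by rw [(h0 z hz).2]; rfl
  by_cases hz : z ∈ ball
  · have d1 : ∀ k, DifferentiableAt ℝ (fun w => η₁ w k) z := fun k =>
      ((hη₁ k).differentiableOn one_ne_zero).differentiableAt (isOpen_ball.mem_nhds hz)
    have d2 : ∀ k, DifferentiableAt ℝ (fun w => η₂ w k) z := fun k =>
      ((hη₂ k).differentiableOn one_ne_zero).differentiableAt (isOpen_ball.mem_nhds hz)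
    have dξ : ∀ m n, DifferentiableAt ℝ (fun w => ξ w m n) z := fun m n =>
      ((hξ m n).differentiableOn one_ne_zero).differentiableAt (isOpen_ball.mem_nhds hz)
    rw [dz_mul (d2 0) (dξ 1 1), dzbar_mul (d1 0) (dξ 1 1), dz_mul (d2 1) (dξ 1 0), dzbar_mul (d1 0) (dξ 1 0),
      dz_mul (d2 0) (dξ 0 1), dzbar_mul (d1 1) (dξ 0 1), dz_mul (d2 1) (dξ 0 0), dzbar_mul (d1 1) (dξ 0 0)]
    have c1 := (hcl z hz).1 1 1 0
    have c2 := (hcl z hz).1 0 0 1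
    have c3 := (hcl z hz).2 1 0 1
    have c4 := (hcl z hz).2 0 0 1
    linear_combination (η₂ z 0) * c1 + (η₂ z 1) * c2 + (η₁ z 0) * c3 - (η₁ z 1) * c4
  · have hzK : z ∉ K := fun h => hz (hKb h)
    have hz1 : ∀ k, ∀ w ∉ K, (fun w => η₁ w k) w = 0 := fun k w hw => h01 w hw k
    have hz2 : ∀ k, ∀ w ∉ K, (fun w => η₂ w k) w = 0 := fun k w hw => h02 w hw k
    have hp1 : ∀ k m n, ∀ w ∉ K, (fun w => η₁ w k * ξ w m n) w = 0 := fun k m n w hw => by simp [h01 w hw k]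
    have hp2 : ∀ k m n, ∀ w ∉ K, (fun w => η₂ w k * ξ w m n) w = 0 := fun k m n w hw => by simp [h02 w hw k]
    simp only [dzbar_eq_zero_of_notMem hK (hz1 _) hzK, dz_eq_zero_of_notMem hK (hz2 _) hzK,
      dzbar_eq_zero_of_notMem hK (hp1 _ _ _) hzK, dz_eq_zero_of_notMem hK (hp2 _ _ _) hzK]
    simp

/-- **Exactness on the ball** (SUPPORT for L4.0′): for `η = Σ η¹_k dz_k + Σ η²_l dz̄_l` with coefficients `C¹` on
the ball and vanishing off a compact `K ⊆ ball`, and `ξ` closed with `C¹` coefficients on the ball,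
`∫_{ℂ²} ⟨(dη)^{1,1} ∧ ξ⟩ = 0`. -/
theorem integral_wedgeCoeff11_d11_eq_zero {K : Set (Fin 2 → ℂ)} (hK : IsCompact K) (hKb : K ⊆ ball)
    {η₁ η₂ : (Fin 2 → ℂ) → (Fin 2 → ℂ)} (hη₁ : ∀ k, ContDiffOn ℝ 1 (fun z => η₁ z k) ball)
    (hη₂ : ∀ k, ContDiffOn ℝ 1 (fun z => η₂ z k) ball) (h0 : ∀ z ∉ K, η₁ z = 0 ∧ η₂ z = 0)
    {ξ : (Fin 2 → ℂ) → Form11} (hξ : ∀ k l, ContDiffOn ℝ 1 (fun z => ξ z k l) ball) (hcl : IsClosed11 ξ) :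
    ∫ z, wedgeCoeff11 (Matrix.of fun k l => dz k (fun w => η₂ w l) z - dzbar l (fun w => η₁ w k) z) (ξ z) = 0 := by
  have hid := wedgeCoeff11_d11_eq_sum_dz hK.isClosed hKb hη₁ hη₂ h0 hξ hcl
  simp_rw [hid]
  have hp1 : ∀ k m n, ContDiffOn ℝ 1 (fun w => η₁ w k * ξ w m n) ball ∧
      ∀ w ∉ K, (fun w => η₁ w k * ξ w m n) w = 0 := fun k m n =>
    ⟨(hη₁ k).mul (hξ m n), fun w hw => by simp [show η₁ w k = 0 by rw [(h0 w hw).1]; rfl]⟩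
  have hp2 : ∀ k m n, ContDiffOn ℝ 1 (fun w => η₂ w k * ξ w m n) ball ∧
      ∀ w ∉ K, (fun w => η₂ w k * ξ w m n) w = 0 := fun k m n =>
    ⟨(hη₂ k).mul (hξ m n), fun w hw => by simp [show η₂ w k = 0 by rw [(h0 w hw).2]; rfl]⟩
  exact integral_comb_eight
    (integrable_dz hK hKb (hp2 0 1 1).1 (hp2 0 1 1).2 0) (integrable_dzbar hK hKb (hp1 0 1 1).1 (hp1 0 1 1).2 0)
    (integrable_dz hK hKb (hp2 1 1 0).1 (hp2 1 1 0).2 0) (integrable_dzbar hK hKb (hp1 0 1 0).1 (hp1 0 1 0).2 1)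
    (integrable_dz hK hKb (hp2 0 0 1).1 (hp2 0 0 1).2 1) (integrable_dzbar hK hKb (hp1 1 0 1).1 (hp1 1 0 1).2 0)
    (integrable_dz hK hKb (hp2 1 0 0).1 (hp2 1 0 0).2 1) (integrable_dzbar hK hKb (hp1 1 0 0).1 (hp1 1 0 0).2 1)
    (integral_dz_eq_zero hK hKb (hp2 0 1 1).1 (hp2 0 1 1).2 0) (integral_dzbar_eq_zero hK hKb (hp1 0 1 1).1 (hp1 0 1 1).2 0)
    (integral_dz_eq_zero hK hKb (hp2 1 1 0).1 (hp2 1 1 0).2 0) (integral_dzbar_eq_zero hK hKb (hp1 0 1 0).1 (hp1 0 1 0).2 1)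
    (integral_dz_eq_zero hK hKb (hp2 0 0 1).1 (hp2 0 0 1).2 1) (integral_dzbar_eq_zero hK hKb (hp1 1 0 1).1 (hp1 1 0 1).2 0)
    (integral_dz_eq_zero hK hKb (hp2 1 0 0).1 (hp2 1 0 0).2 1) (integral_dzbar_eq_zero hK hKb (hp1 1 0 0).1 (hp1 1 0 0).2 1)

/-- **Exactness on the ball**, the set-integral form over the ball (= `pair11 ball ((dη)^{1,1}) ξ` once `d11` is a
landed name): the integrand vanishes off `K ⊆ ball`. -/
theorem setIntegral_ball_wedgeCoeff11_d11_eq_zero {K : Set (Fin 2 → ℂ)} (hK : IsCompact K) (hKb : K ⊆ ball)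
    {η₁ η₂ : (Fin 2 → ℂ) → (Fin 2 → ℂ)} (hη₁ : ∀ k, ContDiffOn ℝ 1 (fun z => η₁ z k) ball)
    (hη₂ : ∀ k, ContDiffOn ℝ 1 (fun z => η₂ z k) ball) (h0 : ∀ z ∉ K, η₁ z = 0 ∧ η₂ z = 0)
    {ξ : (Fin 2 → ℂ) → Form11} (hξ : ∀ k l, ContDiffOn ℝ 1 (fun z => ξ z k l) ball) (hcl : IsClosed11 ξ) :
    ∫ z in ball, wedgeCoeff11 (Matrix.of fun k l => dz k (fun w => η₂ w l) z - dzbar l (fun w => η₁ w k) z) (ξ z)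
      = 0 := by
  rw [setIntegral_eq_integral_of_forall_compl_eq_zero, integral_wedgeCoeff11_d11_eq_zero hK hKb hη₁ hη₂ h0 hξ hcl]
  intro z hz
  have hzK : z ∉ K := fun h => hz (hKb h)
  have hz1 : ∀ k, ∀ w ∉ K, (fun w => η₁ w k) w = 0 := fun k w hw => by
    have := congrFun (h0 w hw).1 k; simpa using this
  have hz2 : ∀ k, ∀ w ∉ K, (fun w => η₂ w k) w = 0 := fun k w hw => by
    have := congrFun (h0 w hw).2 k; simpa using this
  rw [wedgeCoeff11_d11_expand]
  simp only [dzbar_eq_zero_of_notMem hK.isClosed (hz1 _) hzK, dz_eq_zero_of_notMem hK.isClosed (hz2 _) hzK]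
  simp

end Summit.Ventures.HodgeRepro.Tier4.Line4

end
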